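import Literature.Analysis.FunctionSpaces.BesselJZeroOneLaplace
import HarnessLib

/-!
# Kernel-checked enclosures of the half-filled Lieb–Wu energy at `U = 2` and `U = 3` (inside the circle)

Family `hubbard`; STEP-0 rung (i) of `hubbard-alg` ("1D Hubbard vs Lieb–Wu to 1e-3") BY NAME at the REFVALS points
`U = 2t` and `U = 3t`, where Takahashi's large-`u` series (Oitmaa–Hamer–Zheng (8.5)–(8.7) / Essler et al. (6.83))
DIVERGES (`u = U/4 < 1`): the tree's enclosures so far cover `U > 4` (`LiebWuEnergyHalfFillingEnclosure{,Table}`: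
`U = 5, 6, 8, 10, 12, 16`) and the boundary `U = 4` (`…EnclosureU4`).

The route is Steps 1–2 of `LiebWuEnergyStrongCouplingSeries` (valid for every `U > 0`):
`e(U) = -4 ln 2/U - 4 Σ_{n ≥ 0} (-1)^n I_{(n+1)U/2}`, `I_c = ∫₀^∞ e^{-cω} g`, `g = J₀J₁/ω - 1/2`, with the Laplace
terms INSIDE OR ON the circle `c ≤ 2` taken from the closed form of `BesselJZeroOneLaplace`
(`I_1`, `I_{3/2}`, `I_2`, kernel-checked there to `2.6e-10`, `1e-11`, `1e-13`), and the remaining `n`-sum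
(`c ≥ 3`) resummed by Step 3 and Fubini into a geometrically convergent `η`-series, exactly as in `…EnclosureU4`:

* `liebWuEnergy_two_eq` — `e(2) = -2 ln 2 - 4 I_1 + 4 I_2 - 4 Σ_m (-1)^{m+1} γ_{m+1} (η(2m+3) - 1 + 2^{-(2m+3)})`;
* `liebWuEnergy_three_eq` — `e(3) = -(4/3) ln 2 - 4 I_{3/2} - 4 Σ_m (-1)^m γ_{m+1}(2/3)^{2m+3} (1 - η(2m+3))`;
* `tsum_U2tail_mem_Icc`, `tsum_U3tail_mem_Icc` — the two `η`-series to `4.7e-10` / `2.2e-10` (22 head terms,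
  `η(3)` to `1.4e-11` by a fourth-order convexity enclosure `dirichletEta_three_mem_Icc'`, `η(5), …, η(45)` by partial
  sums, geometric tail `O((4/9)^m)`);
* **`liebWuEnergy_two_mem_Icc : liebWuEnergy 2 ∈ [-0.8443743424, -0.844374339]`** (width `3.4e-9`; REFVALS
  `-0.844374341125648982531…`), `abs_liebWuEnergy_two_add_le`;
* **`liebWuEnergy_three_mem_Icc : liebWuEnergy 3 ∈ [-0.6900383749, -0.6900383736]`** (width `1.3e-9`; REFVALS
  `-0.690038374277774750705…`), `abs_liebWuEnergy_three_add_le`.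

With these the tree holds `e_LW(U)` by name at `U ∈ {2, 3, 4, 5, 6, 8, 10, 12, 16}`; `U = 1` (`c = 1/2`, expansion
ratio `8/9`) and `U = 1/2` remain interval-arithmetic values of the programme only. No named facts; the private
alternating-series lemmas are copies of the `…EnclosureU4` helpers.

## References

* J. Oitmaa, C. Hamer, W. Zheng, *Series Expansion Methods*, CUP 2006, §8.2.1 eqs. (8.5)–(8.7)
  (key `OitmaaHamerZheng2006`).
* E. H. Lieb, F. Y. Wu, PRL 20 (1968) 1445, eq. (20) (key `LiebWuPRL1968`).
* DLMF 25.2.3 (key `DLMF`).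
-/

noncomputable section

open Filter Set Real Nat MeasureTheory Finset intervalIntegral
open scoped Topology

namespace Literature.Analysis.FunctionSpaces

section U2

open Literature.Analysis.SpecialFunctions (summable_one_div_succ_pow)

/-- **`e(2)` split at and inside the circle.** At `U = 2` Step 2 reads `∫₀^∞ g/(1 + e^{ω}) = Σ_{n ≥ 0} (-1)^n I_{n+1}`;
the terms `I_1` (INSIDE the circle `c = 2`) and `I_2` (ON it) are kept as integrals, and for `n ≥ 2` (`c = n+1 ≥ 3`)
Step 3 and Fubini give `Σ_{n ≥ 2} (-1)^n I_{n+1} = Σ_m (-1)^{m+1} γ_{m+1} (η(2m+3) - 1 + 2^{-(2m+3)})`. Hence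
`liebWuEnergy 2 = -2 ln 2 - 4 I_1 + 4 I_2 - 4 Σ_m (-1)^{m+1} γ_{m+1} (η(2m+3) - 1 + 2^{-(2m+3)})`, the last series
converging geometrically (`0 ≤ η(s) - 1 + 2^{-s} ≤ 3^{-s}`, `γ_{m+1} 3^{-(2m+3)} = O((4/9)^m)`).
[cite: OitmaaHamerZheng2006, §8.2.1 eq. (8.5)] -/
theorem liebWuEnergy_two_eq :
    liebWuEnergy 2 = -2 * Real.log 2 - 4 * (∫ ω in Ioi (0 : ℝ), Real.exp (-ω) * besselJ01Sub ω) +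
      4 * (∫ ω in Ioi (0 : ℝ), Real.exp (-(2 * ω)) * besselJ01Sub ω) -
      4 * ∑' m : ℕ, (-1) ^ (m + 1) * besselJ01Moment (m + 1) *
        (dirichletEta (2 * m + 3) - 1 + 1 / 2 ^ (2 * m + 3)) := by
  -- Step 1 at `U = 2` and Step 2 with `a = 1`, the terms `n = 0, 1` split off
  have h1 := liebWuEnergy_eq_sub_integral (by norm_num : (0 : ℝ) < 2)
  rw [show (2 : ℝ) / 2 = 1 by norm_num] at h1
  simp only [one_mul] at h1
  have h2 := hasSum_integral_besselJ01Sub_fermi (by norm_num : (0 : ℝ) < 1)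
  have h2' := (hasSum_nat_add_iff' 2).mpr h2
  simp only [Finset.sum_range_succ, Finset.sum_range_zero, pow_zero, one_mul, Nat.cast_zero, zero_add,
    Nat.cast_one, pow_one, mul_one] at h2'
  push_cast at h2'
  rw [show ((1 : ℝ) + 1) = 2 by norm_num] at h2'
  -- the double family for `n ≥ 2` (re-indexed from `0`): `c = n + 3 ≥ 3`
  obtain ⟨G, hG⟩ : ∃ G : ℕ → ℕ → ℝ, G = fun (n m : ℕ) =>
      (-1) ^ (n + 2) * ((-1) ^ (m + 1) * besselJ01Moment (m + 1) / ((n : ℝ) + 2 + 1) ^ (2 * m + 3)) :=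
    ⟨_, rfl⟩
  obtain ⟨u, hu⟩ : ∃ u : ℕ → ℝ, u = fun (m : ℕ) => besselJ01Moment (m + 1) * (1 / 9) ^ m := ⟨_, rfl⟩
  obtain ⟨v, hv⟩ : ∃ v : ℕ → ℝ, v = fun (n : ℕ) => 1 / ((n : ℝ) + 2 + 1) ^ 3 := ⟨_, rfl⟩
  have hu0 : ∀ m, 0 ≤ u m := fun m => by rw [hu]; exact mul_nonneg (besselJ01Moment_pos _).le (by positivity)
  have hv0 : ∀ n, 0 ≤ v n := fun n => by rw [hv]; positivity
  have hus : Summable u := by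
    rw [hu]
    have hγ : ∀ m : ℕ, besselJ01Moment (m + 1) ≤ 4 ^ m := by
      intro m
      have h := besselJ01Moment_le (m + 1)
      push_cast at h
      have hm : (0 : ℝ) ≤ m := Nat.cast_nonneg m
      have h4 : (0 : ℝ) < 4 ^ m := by positivity
      calc besselJ01Moment (m + 1) ≤ 4 ^ (m + 1) / (2 * ((m : ℝ) + 1 + 1)) := h
        _ ≤ 4 ^ (m + 1) / 4 := by
            apply div_le_div_of_nonneg_left (by positivity) (by norm_num); linarith
        _ = 4 ^ m := by rw [pow_succ]; ring
    refine Summable.of_nonneg_of_le (fun m => mul_nonneg (besselJ01Moment_pos _).le (by positivity))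
      (fun m => mul_le_mul_of_nonneg_right (hγ m) (by positivity)) ?_
    have e : (fun m : ℕ => (4 : ℝ) ^ m * (1 / 9) ^ m) = fun m => (4 / 9 : ℝ) ^ m := by
      funext m; rw [← mul_pow]; norm_num
    rw [e]
    exact summable_geometric_of_lt_one (by norm_num) (by norm_num)
  have hvs : Summable v := by
    rw [hv]
    have h := (summable_nat_add_iff 2).mpr (summable_one_div_succ_pow (by norm_num : 2 ≤ 3))
    refine h.congr fun n => ?_
    push_cast
    ring
  have hGle : ∀ n m, |G n m| ≤ v n * u m := by
    intro n m
    set x : ℝ := (n : ℝ) + 2 + 1 with hx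
    have hx3 : (3 : ℝ) ≤ x := by rw [hx]; have : (0 : ℝ) ≤ n := Nat.cast_nonneg n; linarith
    have hx0 : 0 < x := by linarith
    have habsG : |G n m| = besselJ01Moment (m + 1) / x ^ (2 * m + 3) := by
      rw [hG]
      simp only
      rw [abs_mul, abs_pow, abs_neg, abs_one, one_pow, one_mul, abs_div, abs_mul, abs_pow, abs_neg, abs_one,
        one_pow, one_mul, abs_of_pos (besselJ01Moment_pos _), abs_of_pos (by positivity : (0 : ℝ) < x ^ (2 * m + 3))]
    have h9 : (9 : ℝ) ^ m ≤ x ^ (2 * m) := by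
      rw [pow_mul]
      exact pow_le_pow_left₀ (by norm_num) (by nlinarith) m
    rw [habsG, hu, hv]
    simp only
    rw [show x ^ (2 * m + 3) = x ^ 3 * x ^ (2 * m) by ring, div_le_iff₀ (by positivity)]
    have e : 1 / x ^ 3 * (besselJ01Moment (m + 1) * (1 / 9) ^ m) * (x ^ 3 * x ^ (2 * m)) =
        besselJ01Moment (m + 1) * (x ^ (2 * m) / 9 ^ m) := by
      field_simp
      rw [one_div_pow]
      field_simp
    rw [e]
    have h1' : (1 : ℝ) ≤ x ^ (2 * m) / 9 ^ m := by rw [le_div_iff₀ (by positivity), one_mul]; exact h9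
    calc besselJ01Moment (m + 1) = besselJ01Moment (m + 1) * 1 := (mul_one _).symm
      _ ≤ besselJ01Moment (m + 1) * (x ^ (2 * m) / 9 ^ m) :=
          mul_le_mul_of_nonneg_left h1' (besselJ01Moment_pos _).le
  have hGs : Summable (Function.uncurry G) := by
    refine Summable.of_norm_bounded (hvs.mul_of_nonneg hus hv0 hu0) fun nm => ?_
    rw [Real.norm_eq_abs]
    exact hGle nm.1 nm.2
  -- rows: Step 3 off the circle (`c = n + 3 ≥ 3`)
  have hrow : ∀ n : ℕ, HasSum (fun m => G n m)
      ((-1) ^ (n + 2) * ∫ ω in Ioi (0 : ℝ), Real.exp (-(((n : ℝ) + 2 + 1) * ω)) * besselJ01Sub ω) := by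
    intro n
    have hc : (2 : ℝ) < (n : ℝ) + 2 + 1 := by have : (0 : ℝ) ≤ n := Nat.cast_nonneg n; linarith
    have h := (hasSum_integral_exp_neg_mul_besselJ01Sub hc).mul_left ((-1 : ℝ) ^ (n + 2))
    rw [hG]
    exact h
  -- columns: the twice-shifted eta series
  have hcol : ∀ m : ℕ, HasSum (fun n => G n m)
      ((-1) ^ (m + 1) * besselJ01Moment (m + 1) * (dirichletEta (2 * m + 3) - 1 + 1 / 2 ^ (2 * m + 3))) := by
    intro m
    have hη := (hasSum_nat_add_iff' 2).mpr (hasSum_dirichletEta (by omega : 2 ≤ 2 * m + 3))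
    simp only [Finset.sum_range_succ, Finset.sum_range_zero, pow_zero, Nat.cast_zero, zero_add, one_pow, div_one,
      Nat.cast_one, pow_one] at hη
    have hη' := hη.mul_left ((-1) ^ (m + 1) * besselJ01Moment (m + 1))
    have e2 : (fun n => G n m) = fun n : ℕ =>
        (-1) ^ (m + 1) * besselJ01Moment (m + 1) * ((-1) ^ (n + 2) / (((n + 2 : ℕ) : ℝ) + 1) ^ (2 * m + 3)) := by
      funext n
      rw [hG]
      simp only
      push_cast
      ring
    have e3 : (-1 : ℝ) ^ (m + 1) * besselJ01Moment (m + 1) * (dirichletEta (2 * m + 3) - 1 + 1 / 2 ^ (2 * m + 3)) =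
        (-1) ^ (m + 1) * besselJ01Moment (m + 1) *
          (dirichletEta (2 * m + 3) - (1 + -1 / ((1 : ℝ) + 1) ^ (2 * m + 3))) := by
      rw [show ((1 : ℝ) + 1) = 2 by norm_num]
      ring
    rw [e2, e3]
    exact hη'
  -- Fubini
  have hswap : ∑' m, ∑' n, G n m = ∑' n, ∑' m, G n m :=
    hGs.tsum_comm' (fun n => (hrow n).summable) (fun m => (hcol m).summable)
  have hT : ∑' m : ℕ, (-1 : ℝ) ^ (m + 1) * besselJ01Moment (m + 1) *
      (dirichletEta (2 * m + 3) - 1 + 1 / 2 ^ (2 * m + 3)) = ∑' m, ∑' n, G n m :=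
    tsum_congr fun m => ((hcol m).tsum_eq).symm
  have hR : ∑' n, ∑' m, G n m = (∫ ω in Ioi (0 : ℝ), besselJ01Sub ω * (1 / (1 + Real.exp ω))) -
      ((∫ ω in Ioi (0 : ℝ), Real.exp (-ω) * besselJ01Sub ω) +
        -1 * ∫ ω in Ioi (0 : ℝ), Real.exp (-(2 * ω)) * besselJ01Sub ω) := by
    rw [← h2'.tsum_eq]
    exact tsum_congr fun n => (hrow n).tsum_eq
  rw [h1, hT, hswap, hR]
  ring

/-! ## Alternating series with convex terms (the half-term bounds; private copies of the `…EnclosureU4` helpers) -/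

section Alternating

variable {f : ℕ → ℝ}

/-- For an antitone summable `f`: `0 ≤ Σ (-1)^i f i ≤ f 0`. [folklore] -/
private theorem tsum_alternating_nonneg_le (hfa : Antitone f) (hfs : Summable f) :
    0 ≤ ∑' i, (-1) ^ i * f i ∧ ∑' i, (-1) ^ i * f i ≤ f 0 := by
  have h0 := alternating_series_error_bound f hfa hfs 0
  have h1 := alternating_series_error_bound f hfa hfs 1
  simp only [Finset.sum_range_zero, sub_zero] at h0
  simp only [Finset.sum_range_one, pow_zero, one_mul] at h1
  have h01 : f 1 ≤ f 0 := hfa (by norm_num)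
  rw [abs_le] at h0 h1
  constructor <;> linarith [h0.2, h1.1]

/-- `Σ (-1)^i (f i - f (i+1)) = 2 Σ (-1)^i f i - f 0` for summable `f`. [folklore] -/
private theorem tsum_alternating_sub_succ (hfs : Summable f) :
    ∑' i, (-1) ^ i * (f i - f (i + 1)) = 2 * ∑' i, (-1) ^ i * f i - f 0 := by
  have h1 : Summable fun i => (-1 : ℝ) ^ i * f i := hfs.alternating
  have h2 : Summable fun i => (-1 : ℝ) ^ i * f (i + 1) := ((summable_nat_add_iff 1).mpr hfs).alternating
  have hshift : ∑' i, (-1 : ℝ) ^ i * f i = (-1 : ℝ) ^ 0 * f 0 + ∑' i, (-1 : ℝ) ^ (i + 1) * f (i + 1) :=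
    h1.tsum_eq_zero_add
  have e : ∑' i, (-1 : ℝ) ^ (i + 1) * f (i + 1) = -∑' i, (-1 : ℝ) ^ i * f (i + 1) := by
    rw [← tsum_neg]; congr 1; funext i; rw [pow_succ]; ring
  have e2 : (fun i => (-1 : ℝ) ^ i * (f i - f (i + 1))) = fun i => (-1) ^ i * f i - (-1) ^ i * f (i + 1) := by
    funext i; ring
  rw [e2, h1.tsum_sub h2]
  rw [e, pow_zero, one_mul] at hshift
  linarith

/-- Convex alternating series: `f 0/2 ≤ Σ (-1)^i f i ≤ f 0 - f 1/2`. [folklore] -/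
private theorem tsum_alternating_bounds_of_convex (hfs : Summable f) (hc : Antitone fun i => f i - f (i + 1)) :
    f 0 / 2 ≤ ∑' i, (-1) ^ i * f i ∧ ∑' i, (-1) ^ i * f i ≤ f 0 - f 1 / 2 := by
  have hgs : Summable fun i => f i - f (i + 1) := hfs.sub ((summable_nat_add_iff 1).mpr hfs)
  have h := tsum_alternating_nonneg_le hc hgs
  rw [tsum_alternating_sub_succ hfs] at h
  constructor <;> linarith [h.1, h.2]

/-- Third order. [folklore] -/
private theorem tsum_alternating_bounds_of_convex₂ (hfs : Summable f)
    (hc2 : Antitone fun i => (f i - f (i + 1)) - (f (i + 1) - f (i + 2))) :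
    f 0 / 2 + (f 0 - f 1) / 4 ≤ ∑' i, (-1) ^ i * f i ∧
      ∑' i, (-1) ^ i * f i ≤ f 0 / 2 + (f 0 - f 1) / 2 - (f 1 - f 2) / 4 := by
  have hgs : Summable fun i => f i - f (i + 1) := hfs.sub ((summable_nat_add_iff 1).mpr hfs)
  have h := tsum_alternating_bounds_of_convex hgs hc2
  rw [tsum_alternating_sub_succ hfs] at h
  constructor <;> linarith [h.1, h.2]

/-- Fourth order. [folklore] -/
private theorem tsum_alternating_bounds_of_convex₃ (hfs : Summable f)
    (hc3 : Antitone fun i => ((f i - f (i + 1)) - (f (i + 1) - f (i + 2))) -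
      ((f (i + 1) - f (i + 2)) - (f (i + 2) - f (i + 3)))) :
    f 0 / 2 + (f 0 - f 1) / 4 + ((f 0 - f 1) - (f 1 - f 2)) / 8 ≤ ∑' i, (-1) ^ i * f i ∧
      ∑' i, (-1) ^ i * f i ≤
        f 0 / 2 + (f 0 - f 1) / 4 + ((f 0 - f 1) - (f 1 - f 2)) / 4 - ((f 1 - f 2) - (f 2 - f 3)) / 8 := by
  have hgs : Summable fun i => f i - f (i + 1) := hfs.sub ((summable_nat_add_iff 1).mpr hfs)
  have h := tsum_alternating_bounds_of_convex₂ hgs hc3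
  rw [tsum_alternating_sub_succ hfs] at h
  constructor <;> linarith [h.1, h.2]

end Alternating

/-! ## A tight `η(3)`: fourth-order convexity enclosure of the 100-term remainder -/

/-- **`η(3)` to `7e-12`** (`η(3) = (3/4)ζ(3) = 0.901542677369695714…`): the alternating remainder
`Σ_j (-1)^j b_j`, `b_j = 1/(j+101)³`, lies in `[b₀/2 + Δb₀/4 + Δ²b₀/8, b₀/2 + Δb₀/4 + Δ²b₀/4 - Δ²b₁/8]` since
`Δ⁴ b ≥ 0` (`1/y³` is completely monotone: `Δ⁴(1/y³) = P(y)/(y³⋯(y+4)³)`, `P` with non-negative coefficients).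
[cite: DLMF, 25.2.3] -/
theorem dirichletEta_three_mem_Icc' :
    dirichletEta 3 ∈ Set.Icc (0.901542677363 : ℝ) 0.901542677377 := by
  have h := hasSum_dirichletEta (by norm_num : 2 ≤ 3)
  have hs := h.summable
  have hsplit := hs.sum_add_tsum_nat_add 100
  rw [h.tsum_eq] at hsplit
  have htail : ∑' i : ℕ, (fun n : ℕ => (-1 : ℝ) ^ n / ((n : ℝ) + 1) ^ 3) (i + 100) =
      ∑' i : ℕ, (-1 : ℝ) ^ i * (1 / ((i : ℝ) + 100 + 1) ^ 3) := by
    refine tsum_congr fun i => ?_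
    simp only
    push_cast
    rw [pow_add, show ((-1 : ℝ)) ^ 100 = 1 by norm_num]
    ring
  have hbs : Summable fun i : ℕ => 1 / ((i : ℝ) + 100 + 1) ^ 3 := by
    have := (summable_nat_add_iff 100).mpr (summable_one_div_succ_pow (by norm_num : 2 ≤ 3))
    refine this.congr fun i => ?_
    push_cast
    rfl
  have hconv : Antitone fun i : ℕ =>
      ((1 / ((i : ℝ) + 100 + 1) ^ 3 - 1 / (((i + 1 : ℕ) : ℝ) + 100 + 1) ^ 3) -
        (1 / (((i + 1 : ℕ) : ℝ) + 100 + 1) ^ 3 - 1 / (((i + 2 : ℕ) : ℝ) + 100 + 1) ^ 3)) -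
      ((1 / (((i + 1 : ℕ) : ℝ) + 100 + 1) ^ 3 - 1 / (((i + 2 : ℕ) : ℝ) + 100 + 1) ^ 3) -
        (1 / (((i + 2 : ℕ) : ℝ) + 100 + 1) ^ 3 - 1 / (((i + 3 : ℕ) : ℝ) + 100 + 1) ^ 3)) := by
    refine antitone_nat_of_succ_le fun i => ?_
    push_cast
    set y : ℝ := (i : ℝ) + 100 + 1 with hy
    have hy0 : 0 < y := by rw [hy]; positivity
    have e1 : (i : ℝ) + 1 + 100 + 1 = y + 1 := by rw [hy]; ring
    have e2 : (i : ℝ) + 2 + 100 + 1 = y + 2 := by rw [hy]; ring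
    have e3 : (i : ℝ) + 3 + 100 + 1 = y + 3 := by rw [hy]; ring
    have e2' : (i : ℝ) + 1 + 1 + 100 + 1 = y + 2 := by rw [hy]; ring
    have e3' : (i : ℝ) + 1 + 2 + 100 + 1 = y + 3 := by rw [hy]; ring
    have e4' : (i : ℝ) + 1 + 3 + 100 + 1 = y + 4 := by rw [hy]; ring
    rw [e1, e2, e3, e2', e3', e4']
    have key : ((1 / y ^ 3 - 1 / (y + 1) ^ 3) - (1 / (y + 1) ^ 3 - 1 / (y + 2) ^ 3)) -
        ((1 / (y + 1) ^ 3 - 1 / (y + 2) ^ 3) - (1 / (y + 2) ^ 3 - 1 / (y + 3) ^ 3)) -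
        (((1 / (y + 1) ^ 3 - 1 / (y + 2) ^ 3) - (1 / (y + 2) ^ 3 - 1 / (y + 3) ^ 3)) -
          ((1 / (y + 2) ^ 3 - 1 / (y + 3) ^ 3) - (1 / (y + 3) ^ 3 - 1 / (y + 4) ^ 3))) =
        (360 * y ^ 8 + 5760 * y ^ 7 + 38280 * y ^ 6 + 136800 * y ^ 5 + 284400 * y ^ 4 + 347520 * y ^ 3 +
          240480 * y ^ 2 + 86400 * y + 13824) / (y ^ 3 * (y + 1) ^ 3 * (y + 2) ^ 3 * (y + 3) ^ 3 * (y + 4) ^ 3) := by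
      field_simp
      ring
    have : 0 ≤ ((1 / y ^ 3 - 1 / (y + 1) ^ 3) - (1 / (y + 1) ^ 3 - 1 / (y + 2) ^ 3)) -
        ((1 / (y + 1) ^ 3 - 1 / (y + 2) ^ 3) - (1 / (y + 2) ^ 3 - 1 / (y + 3) ^ 3)) -
        (((1 / (y + 1) ^ 3 - 1 / (y + 2) ^ 3) - (1 / (y + 2) ^ 3 - 1 / (y + 3) ^ 3)) -
          ((1 / (y + 2) ^ 3 - 1 / (y + 3) ^ 3) - (1 / (y + 3) ^ 3 - 1 / (y + 4) ^ 3))) := by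
      rw [key]; positivity
    linarith
  have hb := tsum_alternating_bounds_of_convex₃ hbs hconv
  rw [htail] at hsplit
  rw [Set.mem_Icc, ← hsplit]
  norm_num [Finset.sum_range_succ] at hb ⊢
  constructor <;> linarith [hb.1, hb.2]

/-! ## The geometric part `T₂ = Σ_m (-1)^{m+1} γ_{m+1} (η(2m+3) - 1 + 2^{-(2m+3)})` of `e(2)` -/

/-- `γ_{m+1} ≤ 4^m` (from `γ_{m+1} ≤ 4^{m+1}/(2(m+2))`). [cite: OitmaaHamerZheng2006, §8.2.1 eq. (8.6)] -/
theorem besselJ01Moment_succ_le_four_pow (m : ℕ) : besselJ01Moment (m + 1) ≤ 4 ^ m := by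
  have h := besselJ01Moment_le (m + 1)
  push_cast at h
  have hm : (0 : ℝ) ≤ m := Nat.cast_nonneg m
  calc besselJ01Moment (m + 1) ≤ 4 ^ (m + 1) / (2 * ((m : ℝ) + 1 + 1)) := h
    _ ≤ 4 ^ (m + 1) / 4 := by
        apply div_le_div_of_nonneg_left (by positivity) (by norm_num); linarith
    _ = 4 ^ m := by rw [pow_succ]; ring

/-- `|η(s) - 1 + 2^{-s}| ≤ 3^{-s}` for `s ≥ 2` (two terms of the alternating series). [cite: DLMF, 25.2.3] -/
theorem abs_dirichletEta_sub_one_add_le {s : ℕ} (hs : 2 ≤ s) :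
    |dirichletEta s - 1 + 1 / 2 ^ s| ≤ 1 / 3 ^ s := by
  have h := abs_dirichletEta_sub_sum_le hs 2
  simp only [Finset.sum_range_succ, Finset.sum_range_zero, pow_zero, Nat.cast_zero, zero_add, one_pow, div_one,
    Nat.cast_one, pow_one] at h
  norm_num at h
  have e : dirichletEta s - 1 + 1 / 2 ^ s = dirichletEta s - (1 + -1 / 2 ^ s) := by ring
  rw [e]
  convert h using 2
  norm_num

/-- `|(-1)^{m+1} γ_{m+1} (η(2m+3) - 1 + 2^{-(2m+3)})| ≤ 4^m/3^{2m+3}`. [cite: OitmaaHamerZheng2006, §8.2.1 eq. (8.5)] -/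
theorem abs_U2tail_term_le (m : ℕ) :
    |(-1 : ℝ) ^ (m + 1) * besselJ01Moment (m + 1) * (dirichletEta (2 * m + 3) - 1 + 1 / 2 ^ (2 * m + 3))| ≤
      4 ^ m * (1 / 3 ^ (2 * m + 3)) := by
  rw [abs_mul, abs_mul, abs_pow, abs_neg, abs_one, one_pow, one_mul, abs_of_pos (besselJ01Moment_pos _)]
  exact mul_le_mul (besselJ01Moment_succ_le_four_pow m) (abs_dirichletEta_sub_one_add_le (by omega))
    (abs_nonneg _) (by positivity)

/-- Summability of `T₂`'s terms (`O((4/9)^m)`). [cite: OitmaaHamerZheng2006, §8.2.1 eq. (8.5)] -/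
theorem summable_U2tail :
    Summable fun m : ℕ =>
      (-1 : ℝ) ^ (m + 1) * besselJ01Moment (m + 1) * (dirichletEta (2 * m + 3) - 1 + 1 / 2 ^ (2 * m + 3)) := by
  have hg : Summable fun m : ℕ => (4 : ℝ) ^ m * (1 / 3 ^ (2 * m + 3)) := by
    have h := (summable_geometric_of_lt_one (by norm_num) (by norm_num : (4 : ℝ) / 9 < 1)).mul_left (1 / 27)
    refine h.congr fun m => ?_
    rw [pow_add, pow_mul, div_pow]
    norm_num
    ring
  refine Summable.of_norm_bounded hg fun m => ?_
  rw [Real.norm_eq_abs]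
  exact abs_U2tail_term_le m

/-- **`T₂ ∈ [-0.00827826773, -0.00827826726]`** (width `4.7e-10`; 22 head terms — `η(3)` from
`dirichletEta_three_mem_Icc'`, `η(5), …, η(45)` from partial sums of their alternating series with `N_m` terms,
`N = 125, 35, 17, 11, 8, 6, 5, 5, 4, 4, 4, 3, …` — and the geometric tail
`Σ_{m ≥ 22} ≤ (4^{23}/(48·3^{47}))/(1 - 4/9) ≤ 1e-10`, using `γ_{m+1} ≤ 4^{m+1}/(2(m+2))`).
[cite: OitmaaHamerZheng2006, §8.2.1 eq. (8.5)] -/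
theorem tsum_U2tail_mem_Icc :
    (∑' m : ℕ, (-1 : ℝ) ^ (m + 1) * besselJ01Moment (m + 1) *
        (dirichletEta (2 * m + 3) - 1 + 1 / 2 ^ (2 * m + 3))) ∈
      Set.Icc (-0.00827826773 : ℝ) (-0.00827826726) := by
  set T : ℕ → ℝ := fun m =>
    (-1 : ℝ) ^ (m + 1) * besselJ01Moment (m + 1) * (dirichletEta (2 * m + 3) - 1 + 1 / 2 ^ (2 * m + 3)) with hT
  have hs : Summable T := summable_U2tail
  have hsplit := hs.sum_add_tsum_nat_add 22
  -- the geometric tail after 22 terms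
  have htail_s : Summable fun m => |T (m + 22)| := ((summable_nat_add_iff 22).mpr hs).abs
  have hC : ∀ i : ℕ, |T (i + 22)| ≤ (4 : ℝ) ^ 23 / (48 * 3 ^ 47) * (4 / 9) ^ i := by
    intro i
    rw [hT]
    simp only
    have hγ := besselJ01Moment_le (i + 22 + 1)
    push_cast at hγ
    have hi : (0 : ℝ) ≤ i := Nat.cast_nonneg i
    have hγ' : besselJ01Moment (i + 22 + 1) ≤ 4 ^ (i + 23) / 48 := by
      refine hγ.trans ?_
      rw [show i + 22 + 1 = i + 23 by ring]
      apply div_le_div_of_nonneg_left (by positivity) (by norm_num)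
      linarith
    have hη := abs_dirichletEta_sub_one_add_le (by omega : 2 ≤ 2 * (i + 22) + 3)
    rw [abs_mul, abs_mul, abs_pow, abs_neg, abs_one, one_pow, one_mul, abs_of_pos (besselJ01Moment_pos _)]
    calc besselJ01Moment (i + 22 + 1) * |dirichletEta (2 * (i + 22) + 3) - 1 + 1 / 2 ^ (2 * (i + 22) + 3)|
        ≤ 4 ^ (i + 23) / 48 * (1 / 3 ^ (2 * (i + 22) + 3)) :=
          mul_le_mul hγ' hη (abs_nonneg _) (by positivity)
      _ = (4 : ℝ) ^ 23 / (48 * 3 ^ 47) * (4 / 9) ^ i := by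
          rw [show 2 * (i + 22) + 3 = 2 * i + 47 by ring, pow_add, pow_add, pow_mul, div_pow]
          field_simp
          norm_num
  have hgeo : HasSum (fun i : ℕ => (4 : ℝ) ^ 23 / (48 * 3 ^ 47) * (4 / 9) ^ i)
      ((4 : ℝ) ^ 23 / (48 * 3 ^ 47) * (1 - 4 / 9)⁻¹) :=
    (hasSum_geometric_of_lt_one (by norm_num) (by norm_num)).mul_left _
  have htail : |∑' m, T (m + 22)| ≤ (4 : ℝ) ^ 23 / (48 * 3 ^ 47) * (1 - 4 / 9)⁻¹ := by
    have hn := norm_tsum_le_tsum_norm (f := fun m => T (m + 22)) (by simpa only [Real.norm_eq_abs] using htail_s)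
    simp only [Real.norm_eq_abs] at hn
    refine hn.trans ?_
    rw [← hgeo.tsum_eq]
    exact htail_s.tsum_le_tsum hC hgeo.summable
  rw [abs_le] at htail
  -- the 22 head terms
  obtain ⟨a0, b0⟩ := dirichletEta_three_mem_Icc'
  have q1 := abs_dirichletEta_sub_sum_le (s := 5) (by norm_num) 125
  rw [abs_le] at q1
  norm_num [Finset.sum_range_succ] at q1
  have q2 := abs_dirichletEta_sub_sum_le (s := 7) (by norm_num) 35
  rw [abs_le] at q2
  norm_num [Finset.sum_range_succ] at q2
  have q3 := abs_dirichletEta_sub_sum_le (s := 9) (by norm_num) 17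
  rw [abs_le] at q3
  norm_num [Finset.sum_range_succ] at q3
  have q4 := abs_dirichletEta_sub_sum_le (s := 11) (by norm_num) 11
  rw [abs_le] at q4
  norm_num [Finset.sum_range_succ] at q4
  have q5 := abs_dirichletEta_sub_sum_le (s := 13) (by norm_num) 8
  rw [abs_le] at q5
  norm_num [Finset.sum_range_succ] at q5
  have q6 := abs_dirichletEta_sub_sum_le (s := 15) (by norm_num) 6
  rw [abs_le] at q6
  norm_num [Finset.sum_range_succ] at q6
  have q7 := abs_dirichletEta_sub_sum_le (s := 17) (by norm_num) 5
  rw [abs_le] at q7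
  norm_num [Finset.sum_range_succ] at q7
  have q8 := abs_dirichletEta_sub_sum_le (s := 19) (by norm_num) 5
  rw [abs_le] at q8
  norm_num [Finset.sum_range_succ] at q8
  have q9 := abs_dirichletEta_sub_sum_le (s := 21) (by norm_num) 4
  rw [abs_le] at q9
  norm_num [Finset.sum_range_succ] at q9
  have q10 := abs_dirichletEta_sub_sum_le (s := 23) (by norm_num) 4
  rw [abs_le] at q10
  norm_num [Finset.sum_range_succ] at q10
  have q11 := abs_dirichletEta_sub_sum_le (s := 25) (by norm_num) 4
  rw [abs_le] at q11
  norm_num [Finset.sum_range_succ] at q11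
  have q12 := abs_dirichletEta_sub_sum_le (s := 27) (by norm_num) 3
  rw [abs_le] at q12
  norm_num [Finset.sum_range_succ] at q12
  have q13 := abs_dirichletEta_sub_sum_le (s := 29) (by norm_num) 3
  rw [abs_le] at q13
  norm_num [Finset.sum_range_succ] at q13
  have q14 := abs_dirichletEta_sub_sum_le (s := 31) (by norm_num) 3
  rw [abs_le] at q14
  norm_num [Finset.sum_range_succ] at q14
  have q15 := abs_dirichletEta_sub_sum_le (s := 33) (by norm_num) 3
  rw [abs_le] at q15
  norm_num [Finset.sum_range_succ] at q15
  have q16 := abs_dirichletEta_sub_sum_le (s := 35) (by norm_num) 3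
  rw [abs_le] at q16
  norm_num [Finset.sum_range_succ] at q16
  have q17 := abs_dirichletEta_sub_sum_le (s := 37) (by norm_num) 3
  rw [abs_le] at q17
  norm_num [Finset.sum_range_succ] at q17
  have q18 := abs_dirichletEta_sub_sum_le (s := 39) (by norm_num) 3
  rw [abs_le] at q18
  norm_num [Finset.sum_range_succ] at q18
  have q19 := abs_dirichletEta_sub_sum_le (s := 41) (by norm_num) 3
  rw [abs_le] at q19
  norm_num [Finset.sum_range_succ] at q19
  have q20 := abs_dirichletEta_sub_sum_le (s := 43) (by norm_num) 3
  rw [abs_le] at q20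
  norm_num [Finset.sum_range_succ] at q20
  have q21 := abs_dirichletEta_sub_sum_le (s := 45) (by norm_num) 3
  rw [abs_le] at q21
  norm_num [Finset.sum_range_succ] at q21
  rw [Set.mem_Icc, ← hsplit]
  obtain ⟨tl, htl⟩ : ∃ tl : ℝ, ∑' i, T (i + 22) = tl := ⟨_, rfl⟩
  rw [htl] at htail ⊢
  simp only [hT, Finset.sum_range_succ, Finset.sum_range_zero]
  norm_num [besselJ01Moment_one, besselJ01Moment_two, besselJ01Moment_three, besselJ01Moment_four, besselJ01Moment_five, besselJ01Moment_six, besselJ01Moment_seven, besselJ01Moment_eight, besselJ01Moment_nine, besselJ01Moment_ten, besselJ01Moment_eleven, besselJ01Moment_twelve, besselJ01Moment_13, besselJ01Moment_14, besselJ01Moment_15, besselJ01Moment_16, besselJ01Moment_17, besselJ01Moment_18, besselJ01Moment_19, besselJ01Moment_20, besselJ01Moment_21, besselJ01Moment_22, besselJ01Moment_23] at htail ⊢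
  constructor
  · linarith [htail.1, htail.2, a0, b0, q1.1, q1.2, q2.1, q2.2, q3.1, q3.2, q4.1, q4.2, q5.1, q5.2, q6.1, q6.2, q7.1, q7.2, q8.1, q8.2, q9.1, q9.2, q10.1, q10.2, q11.1, q11.2, q12.1, q12.2, q13.1, q13.2, q14.1, q14.2, q15.1, q15.2, q16.1, q16.2, q17.1, q17.2, q18.1, q18.2, q19.1, q19.2, q20.1, q20.2, q21.1, q21.2]
  · linarith [htail.1, htail.2, a0, b0, q1.1, q1.2, q2.1, q2.2, q3.1, q3.2, q4.1, q4.2, q5.1, q5.2, q6.1, q6.2, q7.1, q7.2, q8.1, q8.2, q9.1, q9.2, q10.1, q10.2, q11.1, q11.2, q12.1, q12.2, q13.1, q13.2, q14.1, q14.2, q15.1, q15.2, q16.1, q16.2, q17.1, q17.2, q18.1, q18.2, q19.1, q19.2, q20.1, q20.2, q21.1, q21.2]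

/-! ## The enclosure of `e_LW(2)` -/

/-- **`e_LW(U = 2) = liebWuEnergy 2 ∈ [-0.8443743424, -0.844374339]`** (width `3.4·10⁻⁹`; the programme's 30-digit
value is `-0.844374341125648982531…`, REFVALS `M1/TL/n1/U2/e0/LiebWu-CERT`). The point `U = 2t` is INSIDE the
circle `u = 1` of Takahashi's series; the `n = 1, 2` Laplace terms `I_1`, `I_2` come from the closed form of
`BesselJZeroOneLaplace`, `ln 2` from Mathlib's `log_two_near_10`, `T₂` from `tsum_U2tail_mem_Icc`.
[cite: LiebWuPRL1968, eq. (20)] -/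
theorem liebWuEnergy_two_mem_Icc : liebWuEnergy 2 ∈ Set.Icc (-0.8443743424) (-0.844374339) := by
  rw [liebWuEnergy_two_eq]
  have hI1 := integral_exp_neg_one_mul_besselJ01Sub_mem_Icc
  simp only [one_mul] at hI1
  have hI2 := integral_exp_neg_two_mul_besselJ01Sub_mem_Icc'
  have hR := tsum_U2tail_mem_Icc
  rw [Set.mem_Icc] at hI1 hI2 hR
  have l := Real.log_two_near_10
  rw [abs_le] at l
  norm_num at l
  rw [Set.mem_Icc]
  constructor
  · linarith [hI1.2, hI2.1, hR.2, l.2]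
  · linarith [hI1.1, hI2.2, hR.1, l.1]

/-- The same as a distance to a round midpoint: `|liebWuEnergy 2 + 0.8443743407| ≤ 1.7·10⁻⁹`.
[cite: LiebWuPRL1968, eq. (20)] -/
theorem abs_liebWuEnergy_two_add_le : |liebWuEnergy 2 + 0.8443743407| ≤ 0.0000000017 := by
  have h := liebWuEnergy_two_mem_Icc
  rw [Set.mem_Icc] at h
  rw [abs_le]
  constructor <;> linarith [h.1, h.2]

end U2

section U3

open Literature.Analysis.SpecialFunctions (summable_one_div_succ_pow)

/-- **`e(3)` split inside the circle.** At `U = 3` Step 2 reads `∫₀^∞ g/(1 + e^{3ω/2}) = Σ_{n ≥ 0} (-1)^n I_{3(n+1)/2}`;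
the `n = 0` term `I_{3/2}` (INSIDE the circle `c = 2`) is kept as an integral, while for `n ≥ 1` (`c = 3(n+1)/2 ≥ 3`)
Step 3 and Fubini give `Σ_{n ≥ 1} (-1)^n I_{3(n+1)/2} = Σ_m (-1)^{m+1} γ_{m+1} (2/3)^{2m+3} (η(2m+3) - 1)`. Hence,
with `a_m = γ_{m+1} (2/3)^{2m+3}`, `liebWuEnergy 3 = -(4/3) ln 2 - 4 I_{3/2} - 4 Σ_m (-1)^m a_m (1 - η(2m+3))`, the
last series converging geometrically (`0 ≤ 1 - η(s) ≤ 2^{-s}`, `a_m 2^{-(2m+3)} = γ_{m+1} 3^{-(2m+3)} = O((4/9)^m)`).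
[cite: OitmaaHamerZheng2006, §8.2.1 eq. (8.5)] -/
theorem liebWuEnergy_three_eq :
    liebWuEnergy 3 = -(4 / 3) * Real.log 2 - 4 * (∫ ω in Ioi (0 : ℝ), Real.exp (-(3 / 2 * ω)) * besselJ01Sub ω) -
      4 * ∑' m : ℕ, (-1) ^ m * (besselJ01Moment (m + 1) * (2 / 3) ^ (2 * m + 3)) * (1 - dirichletEta (2 * m + 3)) := by
  -- Step 1 at `U = 3` and Step 2 with `a = 3/2`
  have h1 := liebWuEnergy_eq_sub_integral (by norm_num : (0 : ℝ) < 3)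
  have h2 := hasSum_integral_besselJ01Sub_fermi (by norm_num : (0 : ℝ) < 3 / 2)
  have h2' := (hasSum_nat_add_iff' 1).mpr h2
  simp only [Finset.sum_range_one, pow_zero, one_mul, Nat.cast_zero, zero_add] at h2'
  push_cast at h2'
  -- the double family for `n ≥ 1` (re-indexed from `0`): `c = 3(n+2)/2 ≥ 3`
  obtain ⟨G, hG⟩ : ∃ G : ℕ → ℕ → ℝ, G = fun (n m : ℕ) =>
      (-1) ^ (n + 1) * ((-1) ^ (m + 1) * besselJ01Moment (m + 1) / (((n : ℝ) + 1 + 1) * (3 / 2)) ^ (2 * m + 3)) :=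
    ⟨_, rfl⟩
  obtain ⟨u, hu⟩ : ∃ u : ℕ → ℝ, u = fun (m : ℕ) =>
      besselJ01Moment (m + 1) * (2 / 3) ^ (2 * m + 3) * (1 / 4) ^ m := ⟨_, rfl⟩
  obtain ⟨v, hv⟩ : ∃ v : ℕ → ℝ, v = fun (n : ℕ) => 1 / ((n : ℝ) + 1 + 1) ^ 3 := ⟨_, rfl⟩
  have hu0 : ∀ m, 0 ≤ u m := fun m => by
    rw [hu]; exact mul_nonneg (mul_nonneg (besselJ01Moment_pos _).le (by positivity)) (by positivity)
  have hv0 : ∀ n, 0 ≤ v n := fun n => by rw [hv]; positivity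
  have hus : Summable u := by
    rw [hu]
    refine Summable.of_nonneg_of_le
      (fun m => mul_nonneg (mul_nonneg (besselJ01Moment_pos _).le (by positivity)) (by positivity))
      (fun m => mul_le_mul_of_nonneg_right (mul_le_mul_of_nonneg_right (besselJ01Moment_succ_le_four_pow m)
        (by positivity)) (by positivity)) ?_
    have e : (fun m : ℕ => (4 : ℝ) ^ m * (2 / 3) ^ (2 * m + 3) * (1 / 4) ^ m) = fun m => (8 / 27 : ℝ) * (4 / 9) ^ m := by
      funext m
      have h1 : ((2 : ℝ) / 3) ^ (2 * m + 3) = 8 / 27 * (4 / 9) ^ m := by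
        rw [pow_add, pow_mul]; norm_num; ring
      have h2 : (4 : ℝ) ^ m * (1 / 4) ^ m = 1 := by rw [← mul_pow]; norm_num
      calc (4 : ℝ) ^ m * (2 / 3) ^ (2 * m + 3) * (1 / 4) ^ m = (4 ^ m * (1 / 4) ^ m) * (2 / 3) ^ (2 * m + 3) := by ring
        _ = 8 / 27 * (4 / 9) ^ m := by rw [h2, h1]; ring
    rw [e]
    exact (summable_geometric_of_lt_one (by norm_num) (by norm_num)).mul_left _
  have hvs : Summable v := by
    rw [hv]
    have h := (summable_nat_add_iff 1).mpr (summable_one_div_succ_pow (by norm_num : 2 ≤ 3))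
    refine h.congr fun n => ?_
    push_cast
    ring
  have hGle : ∀ n m, |G n m| ≤ v n * u m := by
    intro n m
    set x : ℝ := (n : ℝ) + 1 + 1 with hx
    have hx2 : (2 : ℝ) ≤ x := by rw [hx]; have : (0 : ℝ) ≤ n := Nat.cast_nonneg n; linarith
    have hx0 : 0 < x := by linarith
    have habsG : |G n m| = besselJ01Moment (m + 1) * (2 / 3) ^ (2 * m + 3) / x ^ (2 * m + 3) := by
      rw [hG]
      simp only
      rw [abs_mul, abs_pow, abs_neg, abs_one, one_pow, one_mul, abs_div, abs_mul, abs_pow, abs_neg, abs_one,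
        one_pow, one_mul, abs_of_pos (besselJ01Moment_pos _),
        abs_of_pos (by positivity : (0 : ℝ) < (x * (3 / 2)) ^ (2 * m + 3)), mul_pow, div_pow, div_pow]
      field_simp
    have h4 : (4 : ℝ) ^ m ≤ x ^ (2 * m) := by
      rw [pow_mul]
      exact pow_le_pow_left₀ (by norm_num) (by nlinarith) m
    rw [habsG, hu, hv]
    simp only
    rw [show x ^ (2 * m + 3) = x ^ 3 * x ^ (2 * m) by ring, div_le_iff₀ (by positivity)]
    have e : 1 / x ^ 3 * (besselJ01Moment (m + 1) * (2 / 3) ^ (2 * m + 3) * (1 / 4) ^ m) * (x ^ 3 * x ^ (2 * m)) =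
        besselJ01Moment (m + 1) * (2 / 3) ^ (2 * m + 3) * (x ^ (2 * m) / 4 ^ m) := by
      field_simp
      rw [one_div_pow]
      field_simp
    rw [e]
    have h1' : (1 : ℝ) ≤ x ^ (2 * m) / 4 ^ m := by rw [le_div_iff₀ (by positivity), one_mul]; exact h4
    have h0 : 0 ≤ besselJ01Moment (m + 1) * (2 / 3) ^ (2 * m + 3) :=
      mul_nonneg (besselJ01Moment_pos _).le (by positivity)
    calc besselJ01Moment (m + 1) * (2 / 3) ^ (2 * m + 3) = besselJ01Moment (m + 1) * (2 / 3) ^ (2 * m + 3) * 1 :=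
          (mul_one _).symm
      _ ≤ besselJ01Moment (m + 1) * (2 / 3) ^ (2 * m + 3) * (x ^ (2 * m) / 4 ^ m) :=
          mul_le_mul_of_nonneg_left h1' h0
  have hGs : Summable (Function.uncurry G) := by
    refine Summable.of_norm_bounded (hvs.mul_of_nonneg hus hv0 hu0) fun nm => ?_
    rw [Real.norm_eq_abs]
    exact hGle nm.1 nm.2
  -- rows: Step 3 off the circle (`c = 3(n+2)/2 ≥ 3`)
  have hrow : ∀ n : ℕ, HasSum (fun m => G n m)
      ((-1) ^ (n + 1) * ∫ ω in Ioi (0 : ℝ), Real.exp (-(((n : ℝ) + 1 + 1) * (3 / 2) * ω)) * besselJ01Sub ω) := by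
    intro n
    have hc : (2 : ℝ) < ((n : ℝ) + 1 + 1) * (3 / 2) := by have : (0 : ℝ) ≤ n := Nat.cast_nonneg n; nlinarith
    have h := (hasSum_integral_exp_neg_mul_besselJ01Sub hc).mul_left ((-1 : ℝ) ^ (n + 1))
    rw [hG]
    exact h
  -- columns: the shifted eta series
  have hcol : ∀ m : ℕ, HasSum (fun n => G n m)
      ((-1) ^ m * (besselJ01Moment (m + 1) * (2 / 3) ^ (2 * m + 3)) * (1 - dirichletEta (2 * m + 3))) := by
    intro m
    have hη := (hasSum_nat_add_iff' 1).mpr (hasSum_dirichletEta (by omega : 2 ≤ 2 * m + 3))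
    simp only [Finset.sum_range_one, pow_zero, Nat.cast_zero, zero_add, one_pow, div_one] at hη
    have hη' := hη.mul_left ((-1) ^ (m + 1) * (besselJ01Moment (m + 1) * (2 / 3) ^ (2 * m + 3)))
    have e2 : (fun n => G n m) = fun n : ℕ =>
        (-1) ^ (m + 1) * (besselJ01Moment (m + 1) * (2 / 3) ^ (2 * m + 3)) *
          ((-1) ^ (n + 1) / (((n + 1 : ℕ) : ℝ) + 1) ^ (2 * m + 3)) := by
      funext n
      rw [hG]
      simp only
      push_cast
      have hn : (0 : ℝ) < (n : ℝ) + 1 + 1 := by positivity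
      rw [mul_pow, show ((3 : ℝ) / 2) ^ (2 * m + 3) = 1 / (2 / 3) ^ (2 * m + 3) by
        rw [one_div, ← inv_pow]; norm_num]
      field_simp
    have e3 : (-1 : ℝ) ^ m * (besselJ01Moment (m + 1) * (2 / 3) ^ (2 * m + 3)) * (1 - dirichletEta (2 * m + 3)) =
        (-1) ^ (m + 1) * (besselJ01Moment (m + 1) * (2 / 3) ^ (2 * m + 3)) * (dirichletEta (2 * m + 3) - 1) := by
      rw [pow_succ]
      ring
    rw [e2, e3]
    exact hη'
  -- Fubini
  have hswap : ∑' m, ∑' n, G n m = ∑' n, ∑' m, G n m :=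
    hGs.tsum_comm' (fun n => (hrow n).summable) (fun m => (hcol m).summable)
  have hT : ∑' m, (-1 : ℝ) ^ m * (besselJ01Moment (m + 1) * (2 / 3) ^ (2 * m + 3)) * (1 - dirichletEta (2 * m + 3)) =
      ∑' m, ∑' n, G n m := tsum_congr fun m => ((hcol m).tsum_eq).symm
  have hR : ∑' n, ∑' m, G n m = (∫ ω in Ioi (0 : ℝ), besselJ01Sub ω * (1 / (1 + Real.exp (3 / 2 * ω)))) -
      ∫ ω in Ioi (0 : ℝ), Real.exp (-(3 / 2 * ω)) * besselJ01Sub ω := by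
    rw [← h2'.tsum_eq]
    exact tsum_congr fun n => (hrow n).tsum_eq
  rw [h1, hT, hswap, hR]
  ring

/-- `|(-1)^m a_m (1 - η(2m+3))| ≤ 4^m/3^{2m+3}` (`a_m = γ_{m+1}(2/3)^{2m+3}`, `0 ≤ 1 - η(s) ≤ 2^{-s}`).
[cite: OitmaaHamerZheng2006, §8.2.1 eq. (8.5)] -/
theorem abs_U3tail_term_le (m : ℕ) :
    |(-1 : ℝ) ^ m * (besselJ01Moment (m + 1) * (2 / 3) ^ (2 * m + 3)) * (1 - dirichletEta (2 * m + 3))| ≤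
      4 ^ m * (1 / 3 ^ (2 * m + 3)) := by
  have hη := dirichletEta_mem_Icc (by omega : 2 ≤ 2 * m + 3)
  rw [Set.mem_Icc] at hη
  have ha0 : 0 ≤ besselJ01Moment (m + 1) * (2 / 3) ^ (2 * m + 3) := mul_nonneg (besselJ01Moment_pos _).le (by positivity)
  rw [abs_mul, abs_mul, abs_pow, abs_neg, abs_one, one_pow, one_mul, abs_of_nonneg ha0,
    abs_of_nonneg (by linarith [hη.2])]
  have e : (4 : ℝ) ^ m * (1 / 3 ^ (2 * m + 3)) = 4 ^ m * (2 / 3) ^ (2 * m + 3) * (1 / 2 ^ (2 * m + 3)) := by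
    rw [div_pow]; field_simp
  rw [e]
  exact mul_le_mul (mul_le_mul_of_nonneg_right (besselJ01Moment_succ_le_four_pow m) (by positivity))
    (by linarith [hη.1]) (by linarith [hη.2]) (by positivity)

/-- Summability of `T₃`'s terms. [cite: OitmaaHamerZheng2006, §8.2.1 eq. (8.5)] -/
theorem summable_U3tail :
    Summable fun m : ℕ =>
      (-1 : ℝ) ^ m * (besselJ01Moment (m + 1) * (2 / 3) ^ (2 * m + 3)) * (1 - dirichletEta (2 * m + 3)) := by
  have hg : Summable fun m : ℕ => (4 : ℝ) ^ m * (1 / 3 ^ (2 * m + 3)) := by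
    have h := (summable_geometric_of_lt_one (by norm_num) (by norm_num : (4 : ℝ) / 9 < 1)).mul_left (1 / 27)
    refine h.congr fun m => ?_
    rw [pow_add, pow_mul, div_pow]
    norm_num
    ring
  refine Summable.of_norm_bounded hg fun m => ?_
  rw [Real.norm_eq_abs]
  exact abs_U3tail_term_le m

/-- **`T₃ = Σ_m (-1)^m a_m (1 - η(2m+3)) ∈ [0.00910685375, 0.00910685397]`** (width `2.2e-10`; 22 head terms with
the `η`-enclosures of `tsum_U2tail_mem_Icc`, geometric tail `≤ 1e-10` as there).
[cite: OitmaaHamerZheng2006, §8.2.1 eq. (8.5)] -/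
theorem tsum_U3tail_mem_Icc :
    (∑' m : ℕ, (-1 : ℝ) ^ m * (besselJ01Moment (m + 1) * (2 / 3) ^ (2 * m + 3)) * (1 - dirichletEta (2 * m + 3))) ∈
      Set.Icc (0.00910685375 : ℝ) 0.00910685397 := by
  set T : ℕ → ℝ := fun m =>
    (-1 : ℝ) ^ m * (besselJ01Moment (m + 1) * (2 / 3) ^ (2 * m + 3)) * (1 - dirichletEta (2 * m + 3)) with hT
  have hs : Summable T := summable_U3tail
  have hsplit := hs.sum_add_tsum_nat_add 22
  -- the geometric tail after 22 terms
  have htail_s : Summable fun m => |T (m + 22)| := ((summable_nat_add_iff 22).mpr hs).abs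
  have hC : ∀ i : ℕ, |T (i + 22)| ≤ (4 : ℝ) ^ 23 / (48 * 3 ^ 47) * (4 / 9) ^ i := by
    intro i
    rw [hT]
    simp only
    have hγ := besselJ01Moment_le (i + 22 + 1)
    push_cast at hγ
    have hi : (0 : ℝ) ≤ i := Nat.cast_nonneg i
    have hγ' : besselJ01Moment (i + 22 + 1) ≤ 4 ^ (i + 23) / 48 := by
      refine hγ.trans ?_
      rw [show i + 22 + 1 = i + 23 by ring]
      apply div_le_div_of_nonneg_left (by positivity) (by norm_num)
      linarith
    have hη := dirichletEta_mem_Icc (by omega : 2 ≤ 2 * (i + 22) + 3)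
    rw [Set.mem_Icc] at hη
    have ha0 : 0 ≤ besselJ01Moment (i + 22 + 1) * (2 / 3) ^ (2 * (i + 22) + 3) :=
      mul_nonneg (besselJ01Moment_pos _).le (by positivity)
    rw [abs_mul, abs_mul, abs_pow, abs_neg, abs_one, one_pow, one_mul, abs_of_nonneg ha0,
      abs_of_nonneg (by linarith [hη.2])]
    calc besselJ01Moment (i + 22 + 1) * (2 / 3) ^ (2 * (i + 22) + 3) * (1 - dirichletEta (2 * (i + 22) + 3))
        ≤ 4 ^ (i + 23) / 48 * (2 / 3) ^ (2 * (i + 22) + 3) * (1 / 2 ^ (2 * (i + 22) + 3)) :=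
          mul_le_mul (mul_le_mul_of_nonneg_right hγ' (by positivity)) (by linarith [hη.1]) (by linarith [hη.2])
            (by positivity)
      _ = (4 : ℝ) ^ 23 / (48 * 3 ^ 47) * (4 / 9) ^ i := by
          rw [show 2 * (i + 22) + 3 = 2 * i + 47 by ring, pow_add, pow_add, pow_add, pow_mul, pow_mul, div_pow,
            div_pow]
          field_simp
          norm_num
          rw [← mul_pow]
          norm_num
  have hgeo : HasSum (fun i : ℕ => (4 : ℝ) ^ 23 / (48 * 3 ^ 47) * (4 / 9) ^ i)
      ((4 : ℝ) ^ 23 / (48 * 3 ^ 47) * (1 - 4 / 9)⁻¹) :=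
    (hasSum_geometric_of_lt_one (by norm_num) (by norm_num)).mul_left _
  have htail : |∑' m, T (m + 22)| ≤ (4 : ℝ) ^ 23 / (48 * 3 ^ 47) * (1 - 4 / 9)⁻¹ := by
    have hn := norm_tsum_le_tsum_norm (f := fun m => T (m + 22)) (by simpa only [Real.norm_eq_abs] using htail_s)
    simp only [Real.norm_eq_abs] at hn
    refine hn.trans ?_
    rw [← hgeo.tsum_eq]
    exact htail_s.tsum_le_tsum hC hgeo.summable
  rw [abs_le] at htail
  -- the 22 head terms
  obtain ⟨a0, b0⟩ := dirichletEta_three_mem_Icc'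
  have q1 := abs_dirichletEta_sub_sum_le (s := 5) (by norm_num) 125
  rw [abs_le] at q1
  norm_num [Finset.sum_range_succ] at q1
  have q2 := abs_dirichletEta_sub_sum_le (s := 7) (by norm_num) 35
  rw [abs_le] at q2
  norm_num [Finset.sum_range_succ] at q2
  have q3 := abs_dirichletEta_sub_sum_le (s := 9) (by norm_num) 17
  rw [abs_le] at q3
  norm_num [Finset.sum_range_succ] at q3
  have q4 := abs_dirichletEta_sub_sum_le (s := 11) (by norm_num) 11
  rw [abs_le] at q4
  norm_num [Finset.sum_range_succ] at q4
  have q5 := abs_dirichletEta_sub_sum_le (s := 13) (by norm_num) 8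
  rw [abs_le] at q5
  norm_num [Finset.sum_range_succ] at q5
  have q6 := abs_dirichletEta_sub_sum_le (s := 15) (by norm_num) 6
  rw [abs_le] at q6
  norm_num [Finset.sum_range_succ] at q6
  have q7 := abs_dirichletEta_sub_sum_le (s := 17) (by norm_num) 5
  rw [abs_le] at q7
  norm_num [Finset.sum_range_succ] at q7
  have q8 := abs_dirichletEta_sub_sum_le (s := 19) (by norm_num) 5
  rw [abs_le] at q8
  norm_num [Finset.sum_range_succ] at q8
  have q9 := abs_dirichletEta_sub_sum_le (s := 21) (by norm_num) 4
  rw [abs_le] at q9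
  norm_num [Finset.sum_range_succ] at q9
  have q10 := abs_dirichletEta_sub_sum_le (s := 23) (by norm_num) 4
  rw [abs_le] at q10
  norm_num [Finset.sum_range_succ] at q10
  have q11 := abs_dirichletEta_sub_sum_le (s := 25) (by norm_num) 4
  rw [abs_le] at q11
  norm_num [Finset.sum_range_succ] at q11
  have q12 := abs_dirichletEta_sub_sum_le (s := 27) (by norm_num) 3
  rw [abs_le] at q12
  norm_num [Finset.sum_range_succ] at q12
  have q13 := abs_dirichletEta_sub_sum_le (s := 29) (by norm_num) 3
  rw [abs_le] at q13
  norm_num [Finset.sum_range_succ] at q13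
  have q14 := abs_dirichletEta_sub_sum_le (s := 31) (by norm_num) 3
  rw [abs_le] at q14
  norm_num [Finset.sum_range_succ] at q14
  have q15 := abs_dirichletEta_sub_sum_le (s := 33) (by norm_num) 3
  rw [abs_le] at q15
  norm_num [Finset.sum_range_succ] at q15
  have q16 := abs_dirichletEta_sub_sum_le (s := 35) (by norm_num) 3
  rw [abs_le] at q16
  norm_num [Finset.sum_range_succ] at q16
  have q17 := abs_dirichletEta_sub_sum_le (s := 37) (by norm_num) 3
  rw [abs_le] at q17
  norm_num [Finset.sum_range_succ] at q17
  have q18 := abs_dirichletEta_sub_sum_le (s := 39) (by norm_num) 3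
  rw [abs_le] at q18
  norm_num [Finset.sum_range_succ] at q18
  have q19 := abs_dirichletEta_sub_sum_le (s := 41) (by norm_num) 3
  rw [abs_le] at q19
  norm_num [Finset.sum_range_succ] at q19
  have q20 := abs_dirichletEta_sub_sum_le (s := 43) (by norm_num) 3
  rw [abs_le] at q20
  norm_num [Finset.sum_range_succ] at q20
  have q21 := abs_dirichletEta_sub_sum_le (s := 45) (by norm_num) 3
  rw [abs_le] at q21
  norm_num [Finset.sum_range_succ] at q21
  rw [Set.mem_Icc, ← hsplit]
  obtain ⟨tl, htl⟩ : ∃ tl : ℝ, ∑' i, T (i + 22) = tl := ⟨_, rfl⟩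
  rw [htl] at htail ⊢
  simp only [hT, Finset.sum_range_succ, Finset.sum_range_zero]
  norm_num [besselJ01Moment_one, besselJ01Moment_two, besselJ01Moment_three, besselJ01Moment_four, besselJ01Moment_five, besselJ01Moment_six, besselJ01Moment_seven, besselJ01Moment_eight, besselJ01Moment_nine, besselJ01Moment_ten, besselJ01Moment_eleven, besselJ01Moment_twelve, besselJ01Moment_13, besselJ01Moment_14, besselJ01Moment_15, besselJ01Moment_16, besselJ01Moment_17, besselJ01Moment_18, besselJ01Moment_19, besselJ01Moment_20, besselJ01Moment_21, besselJ01Moment_22, besselJ01Moment_23] at htail ⊢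
  constructor
  · linarith [htail.1, htail.2, a0, b0, q1.1, q1.2, q2.1, q2.2, q3.1, q3.2, q4.1, q4.2, q5.1, q5.2, q6.1, q6.2, q7.1, q7.2, q8.1, q8.2, q9.1, q9.2, q10.1, q10.2, q11.1, q11.2, q12.1, q12.2, q13.1, q13.2, q14.1, q14.2, q15.1, q15.2, q16.1, q16.2, q17.1, q17.2, q18.1, q18.2, q19.1, q19.2, q20.1, q20.2, q21.1, q21.2]
  · linarith [htail.1, htail.2, a0, b0, q1.1, q1.2, q2.1, q2.2, q3.1, q3.2, q4.1, q4.2, q5.1, q5.2, q6.1, q6.2, q7.1, q7.2, q8.1, q8.2, q9.1, q9.2, q10.1, q10.2, q11.1, q11.2, q12.1, q12.2, q13.1, q13.2, q14.1, q14.2, q15.1, q15.2, q16.1, q16.2, q17.1, q17.2, q18.1, q18.2, q19.1, q19.2, q20.1, q20.2, q21.1, q21.2]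

/-! ## The enclosure of `e_LW(3)` -/

/-- **`e_LW(U = 3) = liebWuEnergy 3 ∈ [-0.6900383749, -0.6900383736]`** (width `1.3·10⁻⁹`; the programme's
30-digit value is `-0.690038374277774750705…`, REFVALS `M1/TL/n1/U3/e0/LiebWu-CERT`). The point `U = 3t` is
INSIDE the circle of convergence of Takahashi's series; `I_{3/2}` from the closed form of `BesselJZeroOneLaplace`,
`ln 2` from Mathlib's `log_two_near_10`, `T₃` from `tsum_U3tail_mem_Icc`. [cite: LiebWuPRL1968, eq. (20)] -/
theorem liebWuEnergy_three_mem_Icc : liebWuEnergy 3 ∈ Set.Icc (-0.6900383749) (-0.6900383736) := by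
  rw [liebWuEnergy_three_eq]
  have hI := integral_exp_neg_three_halves_mul_besselJ01Sub_mem_Icc
  have hR := tsum_U3tail_mem_Icc
  rw [Set.mem_Icc] at hI hR
  have l := Real.log_two_near_10
  rw [abs_le] at l
  norm_num at l
  rw [Set.mem_Icc]
  constructor
  · linarith [hI.2, hR.2, l.2]
  · linarith [hI.1, hR.1, l.1]

/-- The same as a distance to a round midpoint: `|liebWuEnergy 3 + 0.69003837425| ≤ 7·10⁻¹⁰`.
[cite: LiebWuPRL1968, eq. (20)] -/
theorem abs_liebWuEnergy_three_add_le : |liebWuEnergy 3 + 0.69003837425| ≤ 0.0000000007 := by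
  have h := liebWuEnergy_three_mem_Icc
  rw [Set.mem_Icc] at h
  rw [abs_le]
  constructor <;> linarith [h.1, h.2]

end U3

end Literature.Analysis.FunctionSpaces
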